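import Mathlib
import Summits.CriticalPhenomena.SAWScalingLimit.Theorems.NoFoldBound.Negative.BoundaryRayMkWalk
import Summits.CriticalPhenomena.SAWScalingLimit.Theorems.SAWDevelopingMapInteriorFlatteningOneMouthSimplyConnected
import Summits.CriticalPhenomena.SAWScalingLimit.Theorems.SAWDefectDecoherenceDefectDecoherenceTmExterior

/-!
# The witness domain of the boundary-identity ray: a lattice ball minus a spiral slit

Crux `NoFoldBound` (stmt-CriticalPhenomena-8296), negative side, second support file of the
BOUNDARY-IDENTITY RAY. The domain `Λ = rayDomain` is the Euclidean lattice ball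
`B = {w : dist(c_w, c_v) ≤ √129/3}` (109 vertices, `v = rayV = (0,0,↓)` in the coordinates
`HV = ℤ × ℤ × Bool` of `HexSAWLattice.lean`) minus the 38 vertices of an explicit self-avoiding
SPIRAL SLIT `slitPath` that enters the ball from outside, turns once and a quarter clockwise around
`v` and ends at the neighbour `u = rayU = (0,0,↑)` of `v`; `w₁ = (0,1,↑)`, `w₂ = (1,0,↑)` are the two
other neighbours of `v` (both in `Λ`). Contents:

* `qf`, `ballHV`, `rayBall`, `mem_rayBall_iff` — the ball as a decidable finset: the squared
  distance of face centres is the quadratic form `qf/9` of the coordinates (`normSq_sub` of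
  `…DefectDecoherenceTmExterior`), and `qf ≤ 129` forces the coordinates into `[-4,4]²`;
* `slitPath`, `rayDomain = rayBall ∖ slitPath`, `rayOmega = rayDomain.erase v`, their coordinate
  images `domHV`, `omegaHV` with `mem_rayDomain_iff`, `mem_rayOmega_iff` (membership is decided
  in coordinates);
* **`rayDomain_simplyConnected`, `rayOmega_simplyConnected`** — both are a ball minus a
  self-avoiding walk reaching outside the ball, hence simply connected by
  `stub_oneMouthSimplyConnected` (`…InteriorFlatteningOneMouthSimplyConnected`): the slit, resp. the
  slit extended by `v`, realised as `HexMidEdgeSAW`s by `exists_walk`;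
* the local facts at `v`: `rayV_mem`, `rayU_notMem`, `rayW₁_mem`, `rayW₂_mem`, adjacencies and
  distinctness; and the definition of the rigid boundary phase `bphase Ω b m`.

Sources: H. Duminil-Copin, S. Smirnov, Ann. of Math. 175 (2012), §2 (domains with connected
complement). Sorry-free.
-/

noncomputable section

open Literature.Probability.LatticeModels Literature.Probability.RandomPlanarGeometry.SAW
open Summit.CriticalPhenomena.SAWScalingLimit.Theorems.DefectDecoherence.TipMartingale (normSq_sub dist_sq_eq_normSq)
open Summit.CriticalPhenomena.SAWScalingLimit.Theorems.InteriorFlattening.OneMouth (stub_oneMouthSimplyConnected)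

open Summit.CriticalPhenomena.SAWScalingLimit.Theorems.MassRatio.Renewal.BridgeDictionary (ofHV_injective)

namespace Summit.CriticalPhenomena.SAWScalingLimit.Theorems.NoFoldBound.Negative.BoundaryRay

/-! ### The four vertices at the tip -/

/-- The vertex `v` (outer end of the two target mid-edges), in coordinates. -/
def vHV : HV := (0, 0, true)
/-- The third neighbour `u ∉ Λ` of `v` (the inner end of the slit), in coordinates. -/
def uHV : HV := (0, 0, false)
/-- The neighbour `w₁ ∈ Λ` of `v`, in coordinates. -/
def w₁HV : HV := (0, 1, false)
/-- The neighbour `w₂ ∈ Λ` of `v`, in coordinates. -/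
def w₂HV : HV := (1, 0, false)
/-- `v` as a face of `𝕋`. -/
def rayV : HexVertex := ofHV vHV
/-- `u` as a face of `𝕋`. -/
def rayU : HexVertex := ofHV uHV
/-- `w₁` as a face of `𝕋`. -/
def rayW₁ : HexVertex := ofHV w₁HV
/-- `w₂` as a face of `𝕋`. -/
def rayW₂ : HexVertex := ofHV w₂HV

/-! ### The ball -/

/-- Nine times the squared distance from `c_v` in coordinates: for `w = (a, b, c)`,
`qf w = A² + AB + B²` with `A = 3a + d`, `B = 3b + d`, `d = [c] - 1`. -/
def qf (w : HV) : ℤ :=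
  (3 * w.1 + ((if w.2.2 then 1 else 0) - 1)) ^ 2 +
    (3 * w.1 + ((if w.2.2 then 1 else 0) - 1)) * (3 * w.2.1 + ((if w.2.2 then 1 else 0) - 1)) +
    (3 * w.2.1 + ((if w.2.2 then 1 else 0) - 1)) ^ 2

/-- The ball `{qf ≤ 129}` as a finset of coordinates (it lies in the box `[-4,4]²`). -/
def ballHV : Finset HV :=
  ((Finset.Icc (-4 : ℤ) 4) ×ˢ ((Finset.Icc (-4 : ℤ) 4) ×ˢ (Finset.univ : Finset Bool))).filter
    fun w => qf w ≤ 129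

/-- The ball as a finset of faces of `𝕋`. -/
def rayBall : Finset HexVertex := ballHV.map ⟨ofHV, ofHV_injective⟩

/-- `qf ≤ 129` forces the coordinates into `[-4, 4]²`. -/
theorem abs_le_of_qf_le {w : HV} (h : qf w ≤ 129) :
    -4 ≤ w.1 ∧ w.1 ≤ 4 ∧ -4 ≤ w.2.1 ∧ w.2.1 ≤ 4 := by
  obtain ⟨a, b, c⟩ := w
  simp only [qf] at h
  set d : ℤ := (if c then 1 else 0) - 1 with hd
  have hd' : d = -1 ∨ d = 0 := by cases c <;> simp [hd]
  have hA : 3 * (3 * a + d) ^ 2 ≤ 4 * 129 := by nlinarith [sq_nonneg ((3 * a + d) + 2 * (3 * b + d))]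
  have hB : 3 * (3 * b + d) ^ 2 ≤ 4 * 129 := by nlinarith [sq_nonneg ((3 * b + d) + 2 * (3 * a + d))]
  have hA' : -13 ≤ 3 * a + d ∧ 3 * a + d ≤ 13 := by constructor <;> nlinarith
  have hB' : -13 ≤ 3 * b + d ∧ 3 * b + d ≤ 13 := by constructor <;> nlinarith
  simp only
  rcases hd' with hd1 | hd1 <;> rw [hd1] at hA' hB' <;> omega

/-- Membership in `ballHV` is `qf ≤ 129`. -/
theorem mem_ballHV_iff (w : HV) : w ∈ ballHV ↔ qf w ≤ 129 := by
  constructor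
  · intro h; exact (Finset.mem_filter.1 h).2
  · intro h
    obtain ⟨h1, h2, h3, h4⟩ := abs_le_of_qf_le h
    refine Finset.mem_filter.2 ⟨?_, h⟩
    simp only [Finset.mem_product, Finset.mem_Icc, Finset.mem_univ, and_true]
    exact ⟨⟨h1, h2⟩, h3, h4⟩

/-- Faces versus coordinates for `rayBall`. -/
theorem mem_rayBall_iff_toHV (f : HexVertex) : f ∈ rayBall ↔ toHV f ∈ ballHV := by
  rw [rayBall, Finset.mem_map]
  constructor
  · rintro ⟨w, hw, rfl⟩; simpa using hw
  · intro h; exact ⟨toHV f, h, ofHV_toHV f⟩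

/-- The squared distance of face centres from `c_v` is `qf/9`. -/
theorem normSq_eq_qf (f : HexVertex) :
    Complex.normSq (hexCenter f - hexCenter rayV) = (qf (toHV f) : ℝ) / 9 := by
  obtain ⟨x, i⟩ := f
  have hv : rayV = ((0 : Site 2), (1 : Fin 2)) := by
    refine Prod.ext ?_ rfl
    funext j; fin_cases j <;> rfl
  rw [hv, normSq_sub]
  fin_cases i <;> simp [qf, toHV] <;> ring

/-- **The ball is the Euclidean ball of radius `√129/3` about `c_v`.** -/
theorem mem_rayBall_iff (f : HexVertex) :
    f ∈ rayBall ↔ dist (hexCenter f) (hexCenter rayV) ≤ Real.sqrt 129 / 3 := by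
  rw [mem_rayBall_iff_toHV, mem_ballHV_iff]
  have hd : 0 ≤ dist (hexCenter f) (hexCenter rayV) := dist_nonneg
  have key : dist (hexCenter f) (hexCenter rayV) ^ 2 = (qf (toHV f) : ℝ) / 9 := by
    rw [dist_sq_eq_normSq, normSq_eq_qf]
  have hs : Real.sqrt 129 / 3 = Real.sqrt (129 / 9) := by
    rw [Real.sqrt_div (by norm_num), show Real.sqrt 9 = 3 by
      rw [show (9 : ℝ) = 3 ^ 2 by norm_num, Real.sqrt_sq (by norm_num)]]
  rw [hs, Real.le_sqrt hd (by norm_num), key, div_le_div_iff_of_pos_right (by norm_num)]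
  norm_cast

/-! ### The slit and the domain -/

/-- The spiral slit: a self-avoiding lattice path of 38 vertices from outside the ball (its first
vertex has `qf = 144`) to `u`, turning clockwise once and a quarter around `v`. -/
def slitPath : List HV :=
  [(-4, 4, true), (-3, 4, false), (-3, 3, true), (-3, 3, false), (-3, 2, true), (-3, 2, false),
    (-3, 1, true), (-3, 1, false), (-3, 0, true), (-2, 0, false), (-2, -1, true), (-1, -1, false),
    (-1, -2, true), (0, -2, false), (0, -3, true), (1, -3, false), (1, -3, true), (2, -3, false),
    (2, -3, true), (2, -2, false), (2, -2, true), (3, -2, false), (3, -2, true), (3, -1, false),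
    (3, -1, true), (3, 0, false), (2, 0, true), (2, 1, false), (1, 1, true), (1, 2, false),
    (0, 2, true), (0, 2, false), (-1, 2, true), (-1, 2, false), (-1, 1, true), (-1, 1, false),
    (-1, 0, true), (0, 0, false)]

/-- The door through which the slit enters: the neighbour `(-4,4,↑)` (outside the ball) of its first
vertex. -/
def slitDoor : HV := (-4, 4, false)

/-- The coordinate image of the domain: the ball minus the slit. -/
def domHV : Finset HV := ballHV \ slitPath.toFinset

/-- **The witness domain `Λ`**: the lattice ball minus the spiral slit (72 vertices). -/
def rayDomain : Finset HexVertex := rayBall \ (slitPath.map ofHV).toFinset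

/-- The coordinate image of `Ω = Λ ∖ {v}`. -/
def omegaHV : Finset HV := domHV.erase vHV

/-- **The domain of the identities `Ω = Λ ∖ {v}`** (the two target mid-edges `{v,w₁}`, `{v,w₂}` are
boundary mid-edges of `Ω`). -/
def rayOmega : Finset HexVertex := rayDomain.erase rayV

/-- Membership in `Λ` is decided in coordinates. -/
theorem mem_rayDomain_iff (f : HexVertex) : f ∈ rayDomain ↔ toHV f ∈ domHV := by
  rw [rayDomain, domHV, Finset.mem_sdiff, Finset.mem_sdiff, mem_rayBall_iff_toHV, List.mem_toFinset,
    List.mem_toFinset, List.mem_map]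
  constructor
  · rintro ⟨h1, h2⟩
    exact ⟨h1, fun h => h2 ⟨toHV f, h, ofHV_toHV f⟩⟩
  · rintro ⟨h1, h2⟩
    refine ⟨h1, ?_⟩
    rintro ⟨w, hw, rfl⟩
    exact h2 (by simpa using hw)

/-- Membership in `Ω` is decided in coordinates. -/
theorem mem_rayOmega_iff (f : HexVertex) : f ∈ rayOmega ↔ toHV f ∈ omegaHV := by
  rw [rayOmega, omegaHV, Finset.mem_erase, Finset.mem_erase, mem_rayDomain_iff]
  have : f ≠ rayV ↔ toHV f ≠ vHV := by
    rw [not_iff_not, rayV]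
    constructor
    · rintro rfl; exact toHV_ofHV _
    · intro h; rw [← h, ofHV_toHV]
  rw [this]

/-- `Ω` is the ball minus the slit extended by `v`. -/
theorem rayOmega_eq : rayOmega = rayBall \ ((slitPath ++ [vHV]).map ofHV).toFinset := by
  ext f
  rw [rayOmega, rayDomain, Finset.mem_erase, Finset.mem_sdiff, Finset.mem_sdiff, List.map_append,
    List.toFinset_append, Finset.mem_union]
  simp only [List.map_cons, List.map_nil, List.toFinset_cons, List.toFinset_nil,
    Finset.mem_insert, Finset.notMem_empty, or_false, rayV]
  tauto

/-! ### Simple connectivity -/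

/-- **`Λ` is simply connected**: it is the ball minus a self-avoiding walk that starts outside the
ball (`stub_oneMouthSimplyConnected`). -/
theorem rayDomain_simplyConnected : hexDomainSimplyConnected rayDomain := by
  -- the slit as a walk of its own vertex set, from the door `slitDoor` to the mid-edge `{u, v}`
  have hΩ : ∀ f, f ∈ (slitPath.map ofHV).toFinset ↔ toHV f ∈ slitPath.toFinset := by
    intro f
    rw [List.mem_toFinset, List.mem_toFinset, List.mem_map]
    constructor
    · rintro ⟨w, hw, rfl⟩; simpa using hw
    · intro h; exact ⟨toHV f, h, ofHV_toHV f⟩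
  have hP : slitPath ≠ [] := by decide
  obtain ⟨γ, hγ, -⟩ := exists_walk (ob := slitDoor) (om := vHV) hΩ (by decide) hP
  have hout : ∃ t ∈ γ.verts, t ∉ rayBall := by
    refine ⟨ofHV (-4, 4, true), ?_, ?_⟩
    · rw [hγ]; decide
    · rw [mem_rayBall_iff_toHV, toHV_ofHV]; decide
  have h := stub_oneMouthSimplyConnected rayV (Real.sqrt 129 / 3) rayBall mem_rayBall_iff _ _ _ γ hout
  rw [hγ] at h
  exact h

/-- **`Ω = Λ ∖ {v}` is simply connected**: the ball minus the slit extended by `v` (which ends at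
the mid-edge `{v, w₁}`). -/
theorem rayOmega_simplyConnected : hexDomainSimplyConnected rayOmega := by
  have hΩ : ∀ f, f ∈ ((slitPath ++ [vHV]).map ofHV).toFinset ↔ toHV f ∈ (slitPath ++ [vHV]).toFinset := by
    intro f
    rw [List.mem_toFinset, List.mem_toFinset, List.mem_map]
    constructor
    · rintro ⟨w, hw, rfl⟩; simpa using hw
    · intro h; exact ⟨toHV f, h, ofHV_toHV f⟩
  have hP : slitPath ++ [vHV] ≠ [] := by simp
  obtain ⟨γ, hγ, -⟩ := exists_walk (ob := slitDoor) (om := w₁HV) hΩ (by decide) hP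
  have hout : ∃ t ∈ γ.verts, t ∉ rayBall := by
    refine ⟨ofHV (-4, 4, true), ?_, ?_⟩
    · rw [hγ]; simp [slitPath]
    · rw [mem_rayBall_iff_toHV, toHV_ofHV]; decide
  have h := stub_oneMouthSimplyConnected rayV (Real.sqrt 129 / 3) rayBall mem_rayBall_iff _ _ _ γ hout
  rw [hγ, ← rayOmega_eq] at h
  exact h

/-! ### The configuration at the tip -/

/-- `v ∈ Λ`. -/
theorem rayV_mem : rayV ∈ rayDomain := by rw [mem_rayDomain_iff, rayV, toHV_ofHV]; decide
/-- `u ∉ Λ` (it is the last vertex of the slit). -/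
theorem rayU_notMem : rayU ∉ rayDomain := by rw [mem_rayDomain_iff, rayU, toHV_ofHV]; decide
/-- `w₁ ∈ Λ`. -/
theorem rayW₁_mem : rayW₁ ∈ rayDomain := by rw [mem_rayDomain_iff, rayW₁, toHV_ofHV]; decide
/-- `w₂ ∈ Λ`. -/
theorem rayW₂_mem : rayW₂ ∈ rayDomain := by rw [mem_rayDomain_iff, rayW₂, toHV_ofHV]; decide
/-- `v ∼ u`. -/
theorem adj_rayV_rayU : hexGraph.Adj rayV rayU := (hexGraph_adj_ofHV _ _).2 (by decide)
/-- `v ∼ w₁`. -/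
theorem adj_rayV_rayW₁ : hexGraph.Adj rayV rayW₁ := (hexGraph_adj_ofHV _ _).2 (by decide)
/-- `v ∼ w₂`. -/
theorem adj_rayV_rayW₂ : hexGraph.Adj rayV rayW₂ := (hexGraph_adj_ofHV _ _).2 (by decide)
/-- `u ≠ w₁`. -/
theorem rayU_ne_rayW₁ : rayU ≠ rayW₁ := fun h => absurd (ofHV_injective h) (by decide)
/-- `u ≠ w₂`. -/
theorem rayU_ne_rayW₂ : rayU ≠ rayW₂ := fun h => absurd (ofHV_injective h) (by decide)
/-- `w₁ ≠ w₂`. -/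
theorem rayW₁_ne_rayW₂ : rayW₁ ≠ rayW₂ := fun h => absurd (ofHV_injective h) (by decide)
/-- `w₁ ∈ Ω`. -/
theorem rayW₁_mem_rayOmega : rayW₁ ∈ rayOmega := by rw [mem_rayOmega_iff, rayW₁, toHV_ofHV]; decide
/-- `w₂ ∈ Ω`. -/
theorem rayW₂_mem_rayOmega : rayW₂ ∈ rayOmega := by rw [mem_rayOmega_iff, rayW₂, toHV_ofHV]; decide
/-- `v ∉ Ω`. -/
theorem rayV_notMem_rayOmega : rayV ∉ rayOmega := by simp [rayOmega]

/-- The target mid-edge `{v, w₁}` is a boundary mid-edge of `Ω`. -/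
theorem target₁_mem_boundary : s(rayV, rayW₁) ∈ hexDomainBoundary rayOmega :=
  ⟨(SimpleGraph.mem_edgeSet hexGraph).2 adj_rayV_rayW₁, rayV, rayW₁, rfl, rayW₁_mem_rayOmega,
    rayV_notMem_rayOmega⟩

/-- The target mid-edge `{v, w₂}` is a boundary mid-edge of `Ω`. -/
theorem target₂_mem_boundary : s(rayV, rayW₂) ∈ hexDomainBoundary rayOmega :=
  ⟨(SimpleGraph.mem_edgeSet hexGraph).2 adj_rayV_rayW₂, rayV, rayW₂, rfl, rayW₂_mem_rayOmega,
    rayV_notMem_rayOmega⟩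

/-! ### The rigid boundary phase -/

open Classical in
/-- **The rigid boundary phase** `e^{-i(5/8) W(b → m)}` of the walks of `Ω` from the mid-edge `b`
to the mid-edge `m` (the winding of any one of them — they agree for boundary mid-edges of a
simply connected domain, `HexMidEdgeSAW.winding_eq_of_mem_boundary`; `0` if there is none). -/
def bphase (Ω : Finset HexVertex) (b m : Sym2 HexVertex) : ℂ :=
  if h : Nonempty (HexMidEdgeSAW Ω b m) then
    Complex.exp (-Complex.I * (5 / 8 : ℝ) * ((Classical.choice h).winding : ℝ)) else 0

end Summit.CriticalPhenomena.SAWScalingLimit.Theorems.NoFoldBound.Negative.BoundaryRay
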